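import Summits.BirchSwinnertonDyer.BirchSwinnertonDyer.Theses.GenusKolyvaginAtTwo
import Summits.BirchSwinnertonDyer.BirchSwinnertonDyer.Theorems.GenusKolyvaginAtTwoLeafCensusShaCellSplit
import HarnessLib

/-!
# LINE «sha_cell_kex0» — TURNKEY skeleton for the prospective Ш-cell crux `RankOneShaCellBSDTwo` of director-bsd (730)(c)
# («non-CM, r_an = 1, W(ℚ)[2] = 0, #Sel₂(W) ≠ 2 ⟹ BSD₂»; the slice the U₂′ re-cut moves from the residual R′ to the attacked side), route GenusKolyvaginAtTwo

Seat `bsd-line-gk2-p2` g30 (PROVER 2/3, cell bsd-f1-sign2, LINE 23 holder on U₂ 22985), 2026-08-31, written against rev 67 BEFORE the item exists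
(rev 68 pending; free decl name `RankOneShaCellBSDTwo` per LEAD g32 `Lines/LEAD-BRIEF-g32.md`).  **A PROPOSAL, not registered** (there is no item yet);
published under U₂'s crux dir because the Ш-cell is U₂'s sibling slice and its only stub is LINE 23's index relation.  Nothing here proves BSD, the Ш-cell,
the wall or the stub.

THE LINE (three stubs; J rule (a) «the moved slice lands in an ATTACKED crux with a lever»):
* stub WALL = the four WALL rows BY NAME (`Theses.ByReductionTypeAtTwo.*RankZeroAtTwo`, items 19095–19098; spelled fully qualified — rename-proof);
* stub **KEX⁰|Ш** `HeegnerIndexRelationShaCellAtTwo` = LINE 23's 2-primary Gross–Zagier index relation `#Ш(W_K)[2^∞]·4^{ord₂ c + ord₂ C(W)} = 4^{M₀}` at every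
  odd Heegner frame with `2` split, for the rank-one non-CM curves with `W(ℚ)[2] = 0` and `#Sel₂(W) ≠ 2` — VERBATIM the hypothesis `hKEX0Sha` of LEAD g32's
  `…Census.ShaCell.shaCell_of_wall_of_friedbergHoffstein_of_kex0Sha_of_facts` (p801119) and of the v2.6 proposal `Lines/twin_swap_v26_proposal_gk2p2.lean`
  (research; BSD-true; beyond print at `2`; on this cell `Ш(W)[2] ≠ 0`, so the expected exact depth is `M₀ ≥ 1`);
* stub PRINT×6 = `GrossZagierAllLevels` ∧ `MultPublishedInputsAtTwo` ∧ `EntireLFunctionRat` ∧ `MilneAnyModel` ∧ BCDT `nonempty_modularParametrizationData` ∧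
  Friedberg–Hoffstein `friedbergHoffstein_exists_heegnerField_split_twist_ne_zero` (items / statement-only facts, as in LINE 23).
COMPOSITION (kernel, no sorry of its own): `shaCellBSDTwo_of_inputs` = p801119's engine; `ShaCellBSDTwo_of_stubs : ShaCellBSDTwo` concludes the crux TEXT;
the by-name wrapper `RankOneShaCellBSDTwo_of` is the one-liner to add once rev 68 declares the item (commented template at the end).  LOSSLESS:
`heegnerIndexRelationShaCell_of_shaCellBSDTwo_of_wall_of_facts` (p801119 `kex0Sha_of_shaCell_of_wall_of_facts`): modulo WALL + PRINT the stub ⟺ the crux.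
-/

set_option linter.dupNamespace false -- `Summit.<P>.<Sub>` repeats `BirchSwinnertonDyer` (D-0017)

namespace Summit.BirchSwinnertonDyer.BirchSwinnertonDyer.Cruxes.RankOneShaCellBSDTwo.ShaCellKexZero

open scoped Classical NumberField

open Summit.BirchSwinnertonDyer.BirchSwinnertonDyer.Theses.GenusKolyvaginAtTwo
open WeierstrassCurve NumberField Literature.NumberTheory.EllipticCurves Literature.NumberTheory.EllipticCurves.ModularForms
open Summit.BirchSwinnertonDyer.BirchSwinnertonDyer.Theorems
open Summit.BirchSwinnertonDyer.BirchSwinnertonDyer.Theorems.GenusExact.Census.ShaCell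
  (shaCell_of_wall_of_friedbergHoffstein_of_kex0Sha_of_facts kex0Sha_of_shaCell_of_wall_of_facts)

/-! ## The displayed Props -/

/-- THE PROSPECTIVE CRUX TEXT (director-bsd (730)(c); LEAD g32 LEAD-BRIEF-g32 §2, free name `RankOneShaCellBSDTwo`): BSD₂ for every non-CM globally minimal
curve of analytic rank `1` with `W(ℚ)[2] = 0` and `#Sel₂(W) ≠ 2` (⟺ `Ш(W)[2] ≠ 0`, p801119 `shaCell_iff_shaCellSha`). -/
def ShaCellBSDTwo : Prop :=
  ∀ (W : WeierstrassCurve ℚ) [W.IsElliptic] [W.IsGloballyMinimal],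
    ¬ W.HasCM → W.analyticRank = 1 → (∀ P : W.toAffine.Point, 2 • P = 0 → P = 0) → Nat.card (W.selmerGroup 2) ≠ 2 →
      Literature.NumberTheory.EllipticCurves.BSDp W 2

/-- S1′ · the ANCHOR: BSD₂ for every non-CM globally minimal curve of analytic rank `0` (WALL row 1, no Selmer clause). -/
def RankZeroBSDTwo : Prop :=
  ∀ (W : WeierstrassCurve ℚ) [W.IsElliptic] [W.IsGloballyMinimal], ¬ W.HasCM → W.analyticRank = 0 →
    Literature.NumberTheory.EllipticCurves.BSDp W 2

/-- **KEX⁰|Ш · THE ONE RESEARCH STUB**: the 2-primary Gross–Zagier index relation at every odd Heegner frame with `2` split, any globally minimal twin, any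
conductor-`1` datum, for the rank-one non-CM curves with `W(ℚ)[2] = 0` and `#Sel₂(W) ≠ 2` — text VERBATIM = p801119's `hKEX0Sha`. -/
def HeegnerIndexRelationShaCellAtTwo : Prop :=
  ∀ (W : WeierstrassCurve ℚ) [W.IsElliptic] [W.IsGloballyMinimal] [NeZero (W.conductorNorm ℤ)],
    ¬ W.HasCM → W.analyticRank = 1 → (∀ P : W.toAffine.Point, 2 • P = 0 → P = 0) → Nat.card (W.selmerGroup 2) ≠ 2 →
    ∀ (K : Type) [Field K] [NumberField K], IsImaginaryQuadratic K →
      Odd (NumberField.discr K) → NumberField.discr K ≠ -3 → SatisfiesHeegnerHypothesis (W.conductorNorm ℤ) K →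
      ((Ideal.span {(2 : ℤ)}).primesOver (𝓞 K)).ncard = 2 →
      ∀ (Wd : WeierstrassCurve ℚ) [Wd.IsElliptic] [Wd.IsGloballyMinimal],
        (∃ C : VariableChange ℚ, C • W.quadraticTwist (NumberField.discr K : ℚ) = Wd) →
      (W.quadraticTwist (NumberField.discr K : ℚ)).entireLFunction 1 ≠ 0 →
      ∀ (Dt : ModularParametrizationData W (W.conductorNorm ℤ)) (β : ℤ) (ι : K →+* ℂ) (d₁ : KolyvaginHeegnerData Dt β ι 1),
        ∃ M₀ : ℕ,
          (∃ Q : (W.baseChange (ringClassField K ι 1)).toAffine.Point, ((2 ^ M₀ : ℕ) : ℤ) • Q = d₁.derivedPoint) ∧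
          (¬ ∃ Q : (W.baseChange (ringClassField K ι 1)).toAffine.Point, ((2 ^ (M₀ + 1) : ℕ) : ℤ) • Q = d₁.derivedPoint) ∧
          Nat.card (AddCommGroup.primaryComponent (W.baseChange K).sha 2) *
              2 ^ (2 * (padicValInt 2 Dt.c + padicValNat 2 W.tamagawaProduct)) = 2 ^ (2 * M₀)

/-! ## The three stubs (WALL row 1 ×4 bundled · KEX⁰|Ш · PRINT ×6 bundled) -/

/-- stub WALL = items 19095–19098 BY NAME (home decls on route ByReductionTypeAtTwo; the GK2 copies `Wall*` are `Iff.rfl`-equal, p798939 §1). -/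
theorem stub_wallRankZeroAtTwo :
    Theses.ByReductionTypeAtTwo.GoodOrdinaryRankZeroAtTwo ∧ Theses.ByReductionTypeAtTwo.MultiplicativeRankZeroAtTwo ∧
      Theses.ByReductionTypeAtTwo.SupersingularRankZeroAtTwo ∧ Theses.ByReductionTypeAtTwo.AdditiveRankZeroAtTwo := by
  sorry

/-- stub KEX⁰|Ш — the research stub. -/
theorem stub_heegnerIndexRelationShaCell : HeegnerIndexRelationShaCellAtTwo := by
  sorry

/-- stub PRINT = the route's print items BY NAME + BCDT + Friedberg–Hoffstein (statement-only facts). -/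
theorem stub_printFacts :
    GrossZagierAllLevels ∧ MultPublishedInputsAtTwo ∧ EntireLFunctionRat ∧ MilneAnyModel ∧ nonempty_modularParametrizationData ∧
      friedbergHoffstein_exists_heegnerField_split_twist_ne_zero := by
  sorry

/-! ## Closed pieces -/

/-- WALL row 1 ⟹ S1′ (reduction-type tetrachotomy at `2`). -/
theorem rankZeroBSDTwo_of_wall (hOrd : Theses.ByReductionTypeAtTwo.GoodOrdinaryRankZeroAtTwo)
    (hMult : Theses.ByReductionTypeAtTwo.MultiplicativeRankZeroAtTwo) (hSS : Theses.ByReductionTypeAtTwo.SupersingularRankZeroAtTwo)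
    (hAdd : Theses.ByReductionTypeAtTwo.AdditiveRankZeroAtTwo) : RankZeroBSDTwo := by
  intro W _ _ hCM hr
  by_cases hg : W.HasGoodReductionAtPrime 2
  · by_cases hd : ((2 : ℕ) : ℤ) ∣ W.frobeniusTrace 2
    · exact hSS W hCM hr ⟨hg, hd⟩
    · exact hOrd W hCM hr ⟨hg, hd⟩
  · by_cases hm : W.HasMultiplicativeReductionAtPrime 2
    · exact hMult W hCM hr hm
    · exact hAdd W hCM hr ⟨hg, hm⟩

/-- COMPOSITION with displayed inputs: S1′ + KEX⁰|Ш + PRINT×6 prove the crux text (LEAD g32's engine p801119, = p796542 restricted to the cell).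
CONDITIONAL on every displayed hypothesis; closes nothing. [cite: FriedbergHoffstein1995, main theorem] [cite: GrossZagier1986, V.§2 (2.2)]
[cite: Milne1972ArithmeticAV, §1 Thm. 1] -/
theorem shaCellBSDTwo_of_inputs (h1 : RankZeroBSDTwo) (hSha : HeegnerIndexRelationShaCellAtTwo)
    (hGZ : GrossZagierAllLevels) (hGZK : MultPublishedInputsAtTwo) (hLf : EntireLFunctionRat) (hMi : MilneAnyModel)
    (hMP : nonempty_modularParametrizationData) (hFH : friedbergHoffstein_exists_heegnerField_split_twist_ne_zero) :
    ∀ (W : WeierstrassCurve ℚ) [W.IsElliptic] [W.IsGloballyMinimal],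
      ¬ W.HasCM → W.analyticRank = 1 → (∀ P : W.toAffine.Point, 2 • P = 0 → P = 0) → Nat.card (W.selmerGroup 2) ≠ 2 →
        Literature.NumberTheory.EllipticCurves.BSDp W 2 :=
  shaCell_of_wall_of_friedbergHoffstein_of_kex0Sha_of_facts hGZ hGZK hLf hMi hMP hFH h1 hSha

/-- ★ **THE STUB IS LOSSLESS**: the crux + S1′ + PRINT ⟹ KEX⁰|Ш (p801119 `kex0Sha_of_shaCell_of_wall_of_facts`).  CONDITIONAL; closes nothing.
[cite: GrossZagier1986, V.§2 (2.2)] [cite: Milne1972ArithmeticAV, §1 Thm. 1] -/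
theorem heegnerIndexRelationShaCell_of_shaCellBSDTwo_of_wall_of_facts
    (hGZ : ∀ (N : ℕ) [NeZero N] (W : WeierstrassCurve ℚ) (K : Type) [Field K] [NumberField K], gross_zagier N W K)
    (hGZK : rank_eq_analyticRank_of_analyticRank_le_one) (hmod : hasEntireLFunction_rat)
    (hMilneC : Milne1972.bsdQuotient_baseChange_quadratic_anyModel) (h1 : RankZeroBSDTwo) (hCell : ShaCellBSDTwo) :
    HeegnerIndexRelationShaCellAtTwo :=
  kex0Sha_of_shaCell_of_wall_of_facts hGZ hGZK hmod hMilneC h1 hCell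

/-- ★ **THE CRUX TEXT FROM THE THREE STUBS.**  Sorry-free outside the stubs. -/
theorem ShaCellBSDTwo_of_stubs : ShaCellBSDTwo :=
  shaCellBSDTwo_of_inputs
    (rankZeroBSDTwo_of_wall stub_wallRankZeroAtTwo.1 stub_wallRankZeroAtTwo.2.1 stub_wallRankZeroAtTwo.2.2.1 stub_wallRankZeroAtTwo.2.2.2)
    stub_heegnerIndexRelationShaCell
    stub_printFacts.1 stub_printFacts.2.1 stub_printFacts.2.2.1 stub_printFacts.2.2.2.1 stub_printFacts.2.2.2.2.1 stub_printFacts.2.2.2.2.2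

-- AFTER rev 68 (once `Summit.BirchSwinnertonDyer.BirchSwinnertonDyer.Theses.GenusKolyvaginAtTwo.RankOneShaCellBSDTwo` is declared with the text above):
-- theorem RankOneShaCellBSDTwo_of : Summit.BirchSwinnertonDyer.BirchSwinnertonDyer.Theses.GenusKolyvaginAtTwo.RankOneShaCellBSDTwo :=
--   ShaCellBSDTwo_of_stubs

end Summit.BirchSwinnertonDyer.BirchSwinnertonDyer.Cruxes.RankOneShaCellBSDTwo.ShaCellKexZero
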